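import Summits.RiemannHypothesis.RiemannHypothesis.Theorems.WeilFormatCOscTailAbelReal
import Summits.RiemannHypothesis.RiemannHypothesis.Theorems.WeilFormatCPolyWindowConstantsBox
import HarnessLib

/-!
# Format C, design C∞ (E2c, data side): K-fold Abel FAR-TAIL boxes for the trigonometric Hankel entries

Route context: Fourier–Galerkin / Schur-complement certificates of Weil positivity on a window ("format C", C∞ door;
cell memo `run/shared/lean/pub/rh-explicit/rh-explicit-weil-2/gen15/E2-PLAN-v2.md` §6.4 (2)/§6.5; supporting
stmt-RiemannHypothesis-0098; seat rh-explicit-weil-2).  After product-to-sum (`WeilFormatCOscTailProducts`) every trig-weighted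
Hankel entry of the rescaled families has far tails `Σ'_k cos((B₄+k)φ)(m₀/(B₄+k))^s`, `Σ'_k sin((B₄+k)φ)(m₀/(B₄+k))^s`.
`WeilFormatCOscTailAbelReal.abs_tsum_cos/sin_div_pow_sub_le` (K-fold Abel summation) encloses them by an explicit complex main term
± `|Δ^{K−1}(n^{−s})(B₄)|/(2|sin(φ/2)|)^K`.  This file EVALUATES that enclosure in fixed point:

* `CinfCoeff.fdScaledQ m₀ B₄ s j = m₀^s·Δ^j(n^{−s})(B₄)` — exact rational (Newton's formula; `fdScaledQ_cast`);
* `CinfCoeff.hornerFD` — the main-term polynomial `Σ_{j<K} w^j·fdScaledQ j` in complex boxes (`mem_hornerFD`);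
* `CinfCoeff.trigFarScaledBox S Ke ke piI Φ m₀ B₄ s K : Option (MI × MI)` — from boxes `piI ∋ π`, `Φ ∋ φ`: `e^{iφ}`, `e^{iB₄φ}` by
  `MC.expI`, `w = z/(1−z)` by `MC.divBox`, the main term, and the radius `|fdScaledQ (K−1)|/(N.lo/S)^{K/2}` (`K` even,
  `N ∋ |1−z|²`, all rescaling by `m₀^s` done on the rationals BEFORE rounding);
* `CinfCoeff.mem_trigFarScaledBox` — **both boxes enclose the two far tails** (`B₄ ≥ 1`, `s ≥ 2`, `K ≥ 1` even; `sin(φ/2) ≠ 0`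
  is READ OFF the computed `N.lo > 0`, no hypothesis).

Interval plumbing only; standard axioms; no RH claim.
-/

set_option autoImplicit false
-- `Summit.RiemannHypothesis.RiemannHypothesis.…` is the layout-mandated namespace (summit = problem name).
set_option linter.dupNamespace false

open Complex fwdDiff

namespace Summit.RiemannHypothesis.RiemannHypothesis.Theorems.WeilFormatC

open Literature.Analysis.ValidatedNumerics Literature.Analysis.ValidatedNumerics.NumericsMP

namespace CinfCoeff

open WinConst (ratBox mem_ratBox)

variable {S : ℕ}

/-! ## The scaled forward differences (exact rationals) -/

/-- `m₀^s·Δ^j(n ↦ n^{−s})(B₄) = m₀^s·Σ_{k≤j} (−1)^{j−k} C(j,k) (B₄+k)^{−s}` as an exact rational. -/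
def fdScaledQ (m₀ B₄ s j : ℕ) : ℚ :=
  (m₀ : ℚ) ^ s * ∑ k ∈ Finset.range (j + 1),
    (((-1 : ℤ) ^ (j - k) * (j.choose k : ℤ) : ℤ) : ℚ) * (1 / ((B₄ + k : ℕ) : ℚ) ^ s)

/-- `fdScaledQ` is the scaled iterated forward difference of `n ↦ 1/n^s` at `B₄`. -/
theorem fdScaledQ_cast (m₀ B₄ s j : ℕ) :
    ((fdScaledQ m₀ B₄ s j : ℚ) : ℝ) = (m₀ : ℝ) ^ s * (Δ_[1])^[j] (fun n : ℕ ↦ 1 / (n : ℝ) ^ s) B₄ := by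
  rw [fwdDiff_iter_eq_sum_shift]
  unfold fdScaledQ
  push_cast
  congr 1
  refine Finset.sum_congr rfl fun k _ ↦ ?_
  rw [zsmul_eq_mul, smul_eq_mul, mul_one]
  push_cast
  ring

/-! ## The main-term polynomial by Horner -/

/-- `Σ_{i<n} w^i·fdScaledQ (j+i)` by Horner's rule in complex boxes. -/
def hornerFD (S : ℕ) (W : MC) (m₀ B₄ s : ℕ) : ℕ → ℕ → MC
  | 0, _ => MC.ofInt S 0
  | n + 1, j => (MC.ofMI S (ratBox S (fdScaledQ m₀ B₄ s j))).add (MC.mul S W (hornerFD S W m₀ B₄ s n (j + 1)))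

/-- `hornerFD ∋ Σ_{i<n} w^i·fdScaledQ (j+i)`. -/
theorem mem_hornerFD (hS : 0 < S) {w : ℂ} {W : MC} (hw : MC.mem S w W) (m₀ B₄ s : ℕ) :
    ∀ n j : ℕ, MC.mem S (∑ i ∈ Finset.range n, w ^ i * ((((fdScaledQ m₀ B₄ s (j + i) : ℚ) : ℝ) : ℂ)))
      (hornerFD S W m₀ B₄ s n j)
  | 0, j => by simpa [hornerFD] using MC.mem_ofInt S 0
  | n + 1, j => by
    rw [Finset.sum_range_succ', hornerFD]
    simp only [pow_zero, one_mul, add_zero]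
    rw [add_comm]
    refine MC.mem_add ?_ ?_
    · exact MC.mem_ofMI (mem_ratBox S (fdScaledQ m₀ B₄ s j))
    · have e : ∑ i ∈ Finset.range n, w ^ (i + 1) * ((((fdScaledQ m₀ B₄ s (j + (i + 1)) : ℚ) : ℝ) : ℂ))
          = w * ∑ i ∈ Finset.range n, w ^ i * ((((fdScaledQ m₀ B₄ s (j + 1 + i) : ℚ) : ℝ) : ℂ)) := by
        rw [Finset.mul_sum]
        refine Finset.sum_congr rfl fun i _ ↦ ?_
        rw [show j + (i + 1) = j + 1 + i by ring]
        ring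
      rw [e]
      exact MC.mem_mul hS hw (mem_hornerFD hS hw m₀ B₄ s n (j + 1))

/-! ## The K-fold Abel far-tail boxes -/

/-- **Far trig tails by K-fold Abel summation, rescaled by `m₀^s`**: returns the boxes of
`Σ'_k cos((B₄+k)φ)(m₀/(B₄+k))^s` and `Σ'_k sin((B₄+k)φ)(m₀/(B₄+k))^s` (`none` if a phase/division box fails or `|1−z|²`
is not bounded away from `0`).  `Ke`/`ke` = Taylor terms / squarings of `MC.expI`; `K` = Abel order (use an EVEN `K`). -/
def trigFarScaledBox (S Ke ke : ℕ) (piI Φ : MI) (m₀ B₄ s K : ℕ) : Option (MI × MI) :=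
  match MC.expI S Ke ke piI Φ, MC.expI S Ke ke piI (Φ.mulInt B₄) with
  | some Z, some ZB =>
    match MC.divBox S Z ((MC.ofInt S 1).sub Z) with
    | some W =>
      match MC.divBox S (MC.mul S (hornerFD S W m₀ B₄ s K 0) ZB) ((MC.ofInt S 1).sub Z) with
      | some M =>
        if 0 < (MC.normSq S ((MC.ofInt S 1).sub Z)).lo then
          some (M.re.widen ⌈|fdScaledQ m₀ B₄ s (K - 1)|
                  / (((MC.normSq S ((MC.ofInt S 1).sub Z)).lo : ℚ) / S) ^ (K / 2) * S⌉,
                M.im.widen ⌈|fdScaledQ m₀ B₄ s (K - 1)|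
                  / (((MC.normSq S ((MC.ofInt S 1).sub Z)).lo : ℚ) / S) ^ (K / 2) * S⌉)
        else none
      | none => none
    | none => none
  | _, _ => none

/-- **`trigFarScaledBox` encloses both far tails.** -/
theorem mem_trigFarScaledBox (hS : 0 < S) {Ke ke : ℕ} {piI Φ : MI} (hpi : MI.mem S Real.pi piI) {φ : ℝ}
    (hφ : MI.mem S φ Φ) {m₀ B₄ s K : ℕ} (hB₄ : 1 ≤ B₄) (hs : 2 ≤ s) (hK : 1 ≤ K) (hKe : Even K)
    {Bc Bs : MI} (h : trigFarScaledBox S Ke ke piI Φ m₀ B₄ s K = some (Bc, Bs)) :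
    MI.mem S (∑' k : ℕ, Real.cos ((B₄ + k : ℕ) * φ) * ((m₀ : ℝ) / ((B₄ + k : ℕ) : ℝ)) ^ s) Bc ∧
      MI.mem S (∑' k : ℕ, Real.sin ((B₄ + k : ℕ) * φ) * ((m₀ : ℝ) / ((B₄ + k : ℕ) : ℝ)) ^ s) Bs := by
  have hSr : (0 : ℝ) < S := by exact_mod_cast hS
  unfold trigFarScaledBox at h
  split at h
  · rename_i Z ZB hZ hZB
    split at h
    · rename_i W hW
      split at h
      · rename_i M hM
        split_ifs at h with hN
        simp only [Option.some.injEq, Prod.mk.injEq] at h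
        obtain ⟨rfl, rfl⟩ := h
        -- the complex data
        set z : ℂ := Complex.exp (I * φ) with hzdef
        have hz : MC.mem S z Z := by
          have := MC.mem_expI hS hpi hZ hφ
          rwa [mul_comm] at this
        have homz : MC.mem S (1 - z) ((MC.ofInt S 1).sub Z) := by
          have := MC.mem_sub (MC.mem_ofInt S 1) hz
          simpa using this
        have hw : MC.mem S (z / (1 - z)) W := MC.mem_divBox hS hW hz homz
        have hzB : MC.mem S (z ^ B₄) ZB := by
          have := MC.mem_expI hS hpi hZB (MI.mem_mulInt hφ (B₄ : ℤ))
          have e : Complex.exp ((((φ * ((B₄ : ℤ) : ℝ) : ℝ)) : ℂ) * I) = z ^ B₄ := by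
            rw [hzdef, ← Complex.exp_nat_mul]; push_cast; ring_nf
          rwa [e] at this
        have hsum := mem_hornerFD hS hw m₀ B₄ s K 0
        simp only [zero_add] at hsum
        have hMm : MC.mem S ((∑ i ∈ Finset.range K, (z / (1 - z)) ^ i * ((((fdScaledQ m₀ B₄ s i : ℚ) : ℝ) : ℂ)))
            * z ^ B₄ / (1 - z)) M := MC.mem_divBox hS hM (MC.mem_mul hS hsum hzB) homz
        -- `sin(φ/2) ≠ 0` from `N.lo > 0`
        have hNm := MC.mem_normSq hS homz
        have hnpos : (0 : ℝ) < Complex.normSq (1 - z) := by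
          have h1 : ((MC.normSq S ((MC.ofInt S 1).sub Z)).lo : ℝ) ≤ Complex.normSq (1 - z) * S := hNm.1
          have h2 : (0 : ℝ) < ((MC.normSq S ((MC.ofInt S 1).sub Z)).lo : ℝ) := by exact_mod_cast hN
          nlinarith
        have hφ0 : Real.sin (φ / 2) ≠ 0 := by
          intro h0
          have hn : ‖1 - z‖ = 0 := by rw [hzdef, norm_one_sub_cexp_I_mul, h0]; simp
          rw [Complex.normSq_eq_norm_sq, hn] at hnpos
          simp at hnpos
        -- the Abel enclosures, rescaled
        have hA := abs_tsum_cos_div_pow_sub_le hφ0 hs hB₄ hK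
        have hB := abs_tsum_sin_div_pow_sub_le hφ0 hs hB₄ hK
        set A : ℂ := (∑ j ∈ Finset.range K, (Complex.exp (I * φ) / (1 - Complex.exp (I * φ))) ^ j *
            (((((Δ_[1])^[j] (fun n : ℕ ↦ 1 / (n : ℝ) ^ s)) B₄ : ℝ)) : ℂ)) * (Complex.exp (I * φ)) ^ B₄
            / (1 - Complex.exp (I * φ)) with hAdef
        have hV : (∑ i ∈ Finset.range K, (z / (1 - z)) ^ i * ((((fdScaledQ m₀ B₄ s i : ℚ) : ℝ) : ℂ)))
            * z ^ B₄ / (1 - z) = (((m₀ : ℝ) ^ s : ℝ) : ℂ) * A := by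
          rw [hAdef, hzdef]
          have e1 : ∑ i ∈ Finset.range K, (Complex.exp (I * φ) / (1 - Complex.exp (I * φ))) ^ i
                * ((((fdScaledQ m₀ B₄ s i : ℚ) : ℝ) : ℂ))
              = (((m₀ : ℝ) ^ s : ℝ) : ℂ) * ∑ j ∈ Finset.range K,
                  (Complex.exp (I * φ) / (1 - Complex.exp (I * φ))) ^ j *
                    (((((Δ_[1])^[j] (fun n : ℕ ↦ 1 / (n : ℝ) ^ s)) B₄ : ℝ)) : ℂ) := by
            rw [Finset.mul_sum]
            refine Finset.sum_congr rfl fun i _ ↦ ?_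
            rw [fdScaledQ_cast]; push_cast; ring
          rw [e1]; ring
        rw [hV] at hMm
        have hp : (0 : ℝ) ≤ (m₀ : ℝ) ^ s := by positivity
        -- the radius
        set Rq : ℚ := |fdScaledQ m₀ B₄ s (K - 1)|
            / (((MC.normSq S ((MC.ofInt S 1).sub Z)).lo : ℚ) / S) ^ (K / 2) with hRq
        have hrad : (m₀ : ℝ) ^ s * (|((Δ_[1])^[K - 1] (fun n : ℕ ↦ 1 / (n : ℝ) ^ s)) B₄| / (2 * |Real.sin (φ / 2)|) ^ K)
            ≤ (Rq : ℝ) := by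
          obtain ⟨L, hL⟩ := hKe
          have hKL : K / 2 = L := by omega
          have hnum : (m₀ : ℝ) ^ s * |((Δ_[1])^[K - 1] (fun n : ℕ ↦ 1 / (n : ℝ) ^ s)) B₄|
              = |((fdScaledQ m₀ B₄ s (K - 1) : ℚ) : ℝ)| := by
            rw [fdScaledQ_cast, abs_mul, abs_of_nonneg hp]
          have hden : (2 * |Real.sin (φ / 2)|) ^ K = (Complex.normSq (1 - z)) ^ L := by
            rw [hzdef, ← norm_one_sub_cexp_I_mul, Complex.normSq_eq_norm_sq, ← pow_mul]
            congr 1; omega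
          have hlow : ((((MC.normSq S ((MC.ofInt S 1).sub Z)).lo : ℚ) : ℝ) / S) ^ L ≤ (Complex.normSq (1 - z)) ^ L := by
            apply pow_le_pow_left₀ (by positivity)
            rw [div_le_iff₀ hSr]
            exact_mod_cast hNm.1
          have hlowpos : (0 : ℝ) < ((((MC.normSq S ((MC.ofInt S 1).sub Z)).lo : ℚ) : ℝ) / S) ^ L := by
            have : (0 : ℝ) < (((MC.normSq S ((MC.ofInt S 1).sub Z)).lo : ℚ) : ℝ) := by exact_mod_cast hN
            positivity
          rw [mul_div_assoc', hnum, hden, hRq, hKL]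
          push_cast
          exact div_le_div_of_nonneg_left (abs_nonneg _) hlowpos hlow
        have hceil : ((Rq : ℝ)) * S ≤ ((⌈Rq * S⌉ : ℤ) : ℝ) := by
          have := Int.le_ceil (Rq * S)
          exact_mod_cast this
        -- rescaling the two tails
        have ec : (∑' k : ℕ, Real.cos ((B₄ + k : ℕ) * φ) * ((m₀ : ℝ) / ((B₄ + k : ℕ) : ℝ)) ^ s)
            = (m₀ : ℝ) ^ s * ∑' k : ℕ, Real.cos ((B₄ + k : ℕ) * φ) / (((B₄ + k : ℕ)) : ℝ) ^ s := by
          rw [← tsum_mul_left]; refine tsum_congr fun k ↦ ?_; rw [div_pow]; ring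
        have es : (∑' k : ℕ, Real.sin ((B₄ + k : ℕ) * φ) * ((m₀ : ℝ) / ((B₄ + k : ℕ) : ℝ)) ^ s)
            = (m₀ : ℝ) ^ s * ∑' k : ℕ, Real.sin ((B₄ + k : ℕ) * φ) / (((B₄ + k : ℕ)) : ℝ) ^ s := by
          rw [← tsum_mul_left]; refine tsum_congr fun k ↦ ?_; rw [div_pow]; ring
        have hre : ((((m₀ : ℝ) ^ s : ℝ) : ℂ) * A).re = (m₀ : ℝ) ^ s * A.re := by
          rw [Complex.re_ofReal_mul]
        have him : ((((m₀ : ℝ) ^ s : ℝ) : ℂ) * A).im = (m₀ : ℝ) ^ s * A.im := by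
          rw [Complex.im_ofReal_mul]
        constructor
        · refine MI.mem_widen hMm.1 ?_
          rw [hre, ec, ← mul_sub, abs_mul, abs_of_nonneg hp]
          have h1 : (m₀ : ℝ) ^ s * |(∑' k : ℕ, Real.cos ((B₄ + k : ℕ) * φ) / (((B₄ + k : ℕ)) : ℝ) ^ s) - A.re|
              ≤ (Rq : ℝ) := (mul_le_mul_of_nonneg_left hA hp).trans hrad
          exact (mul_le_mul_of_nonneg_right h1 hSr.le).trans hceil
        · refine MI.mem_widen hMm.2 ?_
          rw [him, es, ← mul_sub, abs_mul, abs_of_nonneg hp]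
          have h1 : (m₀ : ℝ) ^ s * |(∑' k : ℕ, Real.sin ((B₄ + k : ℕ) * φ) / (((B₄ + k : ℕ)) : ℝ) ^ s) - A.im|
              ≤ (Rq : ℝ) := (mul_le_mul_of_nonneg_left hB hp).trans hrad
          exact (mul_le_mul_of_nonneg_right h1 hSr.le).trans hceil
      · simp at h
    · simp at h
  · simp at h

end CinfCoeff

end Summit.RiemannHypothesis.RiemannHypothesis.Theorems.WeilFormatC
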